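import Summits.ResolutionOfSingularities.KangarooAtlas.MizutaniProfile
import Mathlib.Algebra.MvPolynomial.Supported
import HarnessLib

/-!
# Mizutani's conjecture `m(e) = 2p^e − 1` — the polynomial tower model, III: transfer of profiles

Cell topic `Summits/ResolutionOfSingularities/KangarooAtlas` (pub-rosobs); namespace
`Summit.ResolutionOfSingularities.KangarooAtlas.Mizutani`.  Continuation of `MizutaniProfile`
(MIZUTANI-PROOF-g59 §1.4 INVARIANCES and the §5 AUTOMORPHISMS).  In-house chain, AI-written; not a
resolution theorem.

How the HS matrix of `ω` changes under maps of the coefficient ring `F[a_κ]`: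

* `hsOp_mul_C_of_dtaylorCoeff` — `(D^{(T)}⊗1)` is linear over the coefficients the pairing does not
  see (`dtaylorCoeff e s = C (C s)`, e.g. `s` a polynomial in the unpaired variables,
  `dtaylorCoeff_eq_of_supported`).
* COMPATIBLE COEFFICIENT MAPS (`hsMatrix_map_of_compat`): a ring map `ψ : F[a_κ] → F'[a_κ']` with
  `dtaylorCoeff e' ∘ ψ = map ψ ∘ dtaylorCoeff e` (criterion `compat_of_generators`: constants to
  constants, `a_{e i} ↦ a_{e' i} + c_i`, unpaired variables to polynomials in unpaired variables)
  carries the HS matrix entrywise: TRANSLATIONS `a ↦ a + c` (§5), SPECIALISATIONS of unpaired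
  variables (`a_c ↦ 0` in the layer lemma of §7, `λ ↦ λ₀` in the degeneration of §5) and BASE
  CHANGE of the constant field are all instances; `profile_le_of_hsMatrix_scaled` /
  `profile_eq_of_hsMatrix_scaled` turn "`H' = D₁ · ψ(H) · D₂` entrywise" into `σ' ≤ σ` (any `ψ`)
  and `σ' = σ` (`ψ` injective, `D₁, D₂` non-vanishing).
* TORUS (`torus s w`): `a_k ↦ s^{w_k} a_k`, `t_i ↦ s^{w_{e i}} t_i` for a scalar `s` the pairing does
  not see (a constant `λ ∈ F`, or an extra unpaired variable `Λ` for the degeneration family):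
  `hsMatrix_torus` (`HS(θω)[T,M] = s^{w·T} θ(HS(ω)[T,M]) s^{w·M}`) and `profile_torus` (invariance
  for `s = λ ∈ F^×`; MIZUTANI-PROOF-g59 §1.4 / §5 "tori … preserve profiles").

References: [Mizutani1973HironakaGroupSchemes] (Remark 2.10); [Oda1983HironakaGroupSchemeII]
(§1 p. 1166); [EGAIV4] Thm. 16.11.2.
-/

open MvPolynomial Literature.AlgebraicGeometry.Resolution

namespace Summit.ResolutionOfSingularities.KangarooAtlas.Mizutani

section Transfer

variable {ι κ κ' F F' : Type*} [CommRing F] [CommRing F'] [Fintype ι] [DecidableEq κ] [DecidableEq κ']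
variable (e : ι → κ) (e' : ι → κ')

/-! ## Coefficients the pairing does not see -/

/-- A coefficient `s ∈ F[a]` in the unpaired variables is a constant for the diagonal Taylor
morphism: `dtaylorCoeff e s = s` (no `u`). [cite: EGAIV4, Thm. 16.11.2] -/
theorem dtaylorCoeff_eq_of_supported {S : Set κ} (hS : ∀ i, e i ∉ S) {s : MvPolynomial κ F}
    (hs : s ∈ supported F S) : dtaylorCoeff (ι := ι) e s = C (C s) := by
  rw [supported_eq_adjoin_X] at hs
  induction hs using Algebra.adjoin_induction with
  | mem x hx =>
    obtain ⟨k, hk, rfl⟩ := hx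
    rw [dtaylorCoeff_X, uOf_of_notMem e k (fun i h => hS i (h ▸ hk)), add_zero]
  | algebraMap c => rw [algebraMap_eq, dtaylorCoeff_C]
  | add x y _ _ hx hy => rw [map_add, hx, hy, map_add, map_add]
  | mul x y _ _ hx hy => rw [map_mul, hx, hy, map_mul, map_mul]

/-- `(D^{(T)}⊗1)` is linear over the coefficients the pairing does not see:
`(D^{(T)}⊗1)(s ω) = s · (D^{(T)}⊗1)(ω)` when `dtaylorCoeff e s = s`.
[cite: EGAIV4, Thm. 16.11.2 (D_p is linear over the constants)] -/
theorem hsOp_C_mul_of_dtaylorCoeff {s : MvPolynomial κ F} (hs : dtaylorCoeff (ι := ι) e s = C (C s))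
    (T : ι →₀ ℕ) (ω : Rel ι κ F) : hsOp e T (C s * ω) = C s * hsOp e T ω := by
  rw [hsOp_apply, map_mul, dtaylor_C, hs, coeff_C_mul, hsOp_apply]

/-! ## Compatible coefficient maps -/

/-- **Compatible coefficient maps intertwine the diagonal Taylor morphisms.**  If
`dtaylorCoeff e' ∘ ψ = map (map ψ) ∘ dtaylorCoeff e` then `dtaylor e' ∘ map ψ = map (map ψ) ∘ dtaylor e`.
[cite: EGAIV4, Thm. 16.11.2 (functoriality of the Taylor morphism)] -/
theorem dtaylor_comp_map_of_compat (ψ : MvPolynomial κ F →+* MvPolynomial κ' F')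
    (hψ : (dtaylorCoeff (ι := ι) e').comp ψ =
      (MvPolynomial.map (MvPolynomial.map ψ)).comp (dtaylorCoeff e)) :
    (dtaylor e').comp (MvPolynomial.map ψ : Rel ι κ F →+* Rel ι κ' F') =
      (MvPolynomial.map (MvPolynomial.map ψ)).comp (dtaylor e) := by
  refine MvPolynomial.ringHom_ext (fun κ₀ => ?_) (fun i => ?_)
  · have h := RingHom.congr_fun hψ κ₀
    simp only [RingHom.comp_apply] at h ⊢
    rw [map_C, dtaylor_C, dtaylor_C, h]
  · simp only [RingHom.comp_apply, map_X, dtaylor_X, map_add, map_C, map_X]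

/-- Hence `(D^{(T)}⊗1)(ψ_* ω) = ψ_* ((D^{(T)}⊗1) ω)` for a compatible coefficient map `ψ`.
[cite: EGAIV4, Thm. 16.11.2 (functoriality of the D_p)] -/
theorem hsOp_map_of_compat (ψ : MvPolynomial κ F →+* MvPolynomial κ' F')
    (hψ : (dtaylorCoeff (ι := ι) e').comp ψ =
      (MvPolynomial.map (MvPolynomial.map ψ)).comp (dtaylorCoeff e))
    (T : ι →₀ ℕ) (ω : Rel ι κ F) :
    hsOp e' T (MvPolynomial.map ψ ω) = MvPolynomial.map ψ (hsOp e T ω) := by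
  have h := RingHom.congr_fun (dtaylor_comp_map_of_compat e e' ψ hψ) ω
  simp only [RingHom.comp_apply] at h
  rw [hsOp_apply, h, coeff_map, hsOp_apply]

/-- **Criterion for compatibility on generators**: `ψ` maps constants to constants, each paired
variable `a_{e i}` to `a_{e' i}` plus a constant, and each unpaired variable to a polynomial in
unpaired variables (`e, e'` injective). Covers translations, specialisations of unpaired variables
and base change. [cite: EGAIV4, Thm. 16.11.2 (functoriality of the Taylor morphism)] -/
theorem compat_of_generators (he : Function.Injective e) (he' : Function.Injective e')
    (φ : F →+* F') (g : κ → MvPolynomial κ' F') (c : ι → F')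
    (hpaired : ∀ i, g (e i) = X (e' i) + C (c i))
    (hunpaired : ∀ k, (∀ i, e i ≠ k) → g k ∈ supported F' (Set.range e')ᶜ) :
    (dtaylorCoeff (ι := ι) e').comp (eval₂Hom (C.comp φ) g) =
      (MvPolynomial.map (MvPolynomial.map (eval₂Hom (C.comp φ) g))).comp (dtaylorCoeff e) := by
  refine MvPolynomial.ringHom_ext (fun a => ?_) (fun k => ?_)
  · simp only [RingHom.comp_apply, eval₂Hom_C, dtaylorCoeff_C, map_C]
  · simp only [RingHom.comp_apply, eval₂Hom_X', dtaylorCoeff_X, map_add, map_C, eval₂Hom_X']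
    by_cases hk : ∃ i, e i = k
    · obtain ⟨i, rfl⟩ := hk
      -- `map (map ψ)` fixes the `u`-variables: `uOf e (e i) = u_i ↦ u_i`
      rw [hpaired i, map_add, dtaylorCoeff_X, dtaylorCoeff_C, uOf_apply e' he', uOf_apply e he,
        map_X, map_add, map_add]
      ring
    · push Not at hk
      rw [dtaylorCoeff_eq_of_supported e' (S := (Set.range e')ᶜ) (fun i h => h ⟨i, rfl⟩)
        (hunpaired k hk), uOf_of_notMem e k hk, map_zero, add_zero]

end Transfer

/-! ## Profiles under (scaled) entrywise images -/

section Scaled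

variable {ι κ κ' F F' : Type*} [Field F] [Field F'] [Fintype ι] [DecidableEq ι] [DecidableEq κ]
  [DecidableEq κ'] (e : ι → κ) (e' : ι → κ') (q : ℕ)

/-- Determinant of a two-sided diagonal scaling of an entrywise image. [folklore] -/
theorem det_submatrix_scaled {A A' : Type*} [CommRing A] [CommRing A'] (ψ : A →+* A')
    {m n : Type*} (H : Matrix m n A) (H' : Matrix m n A') (d₁ : m → A') (d₂ : n → A')
    (h : ∀ i j, H' i j = d₁ i * ψ (H i j) * d₂ j) {r : ℕ} (rows : Fin r → m) (cols : Fin r → n) :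
    (H'.submatrix rows cols).det =
      (∏ a, d₁ (rows a)) * ψ (H.submatrix rows cols).det * ∏ a, d₂ (cols a) := by
  have hM : H'.submatrix rows cols =
      Matrix.diagonal (fun a => d₁ (rows a)) * (H.submatrix rows cols).map ψ *
        Matrix.diagonal (fun a => d₂ (cols a)) := by
    ext a b
    rw [Matrix.mul_diagonal, Matrix.diagonal_mul, Matrix.map_apply, Matrix.submatrix_apply,
      Matrix.submatrix_apply, h]
  rw [hM, Matrix.det_mul, Matrix.det_mul, Matrix.det_diagonal, Matrix.det_diagonal,
    RingHom.map_det, RingHom.mapMatrix_apply]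

/-- **One-sided transfer**: if `HS(ω') = D₁ · ψ(HS(ω)) · D₂` entrywise for SOME ring map `ψ` of
the coefficient rings, then `σ_n(ω') ≤ σ_n(ω)` (a non-zero minor of the left side forces the
corresponding minor of `HS(ω)` to be non-zero). [cite: Mizutani1973HironakaGroupSchemes, Remark 2.10 (in-house proof, §1.4 invariances / §5)] -/
theorem profile_le_of_hsMatrix_scaled (ψ : MvPolynomial κ F →+* MvPolynomial κ' F') (n : ℕ)
    (ω : Rel ι κ F) (ω' : Rel ι κ' F') (d₁ : {T : Box ι q // T.deg ≤ n} → MvPolynomial κ' F')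
    (d₂ : Box ι q → MvPolynomial κ' F')
    (h : ∀ T M, hsMatrix e' q n ω' T M = d₁ T * ψ (hsMatrix e q n ω T M) * d₂ M) :
    profile e' q n ω' ≤ profile e q n ω := by
  by_contra hlt
  push Not at hlt
  obtain ⟨rows, cols, hne⟩ := (le_profile_iff e' q n _ ω').mp (Nat.succ_le_of_lt hlt)
  rw [det_submatrix_scaled ψ _ _ d₁ d₂ h] at hne
  have hne' : (Matrix.submatrix (hsMatrix e q n ω) rows cols).det ≠ 0 := by
    intro h0
    apply hne
    rw [h0, map_zero, mul_zero, zero_mul]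
  have := (le_profile_iff e q n _ ω).mpr ⟨rows, cols, hne'⟩
  omega

/-- **Two-sided transfer**: if `HS(ω') = D₁ · ψ(HS(ω)) · D₂` entrywise with `ψ` injective and
`D₁, D₂` non-vanishing, then `σ_n(ω') = σ_n(ω)` (automorphism invariance pattern of
MIZUTANI-PROOF-g59 §1.4 INVARIANCES). [cite: Mizutani1973HironakaGroupSchemes, Remark 2.10 (in-house proof, §1.4 invariances / §5)] -/
theorem profile_eq_of_hsMatrix_scaled (ψ : MvPolynomial κ F →+* MvPolynomial κ' F')
    (hψ : Function.Injective ψ) (n : ℕ) (ω : Rel ι κ F) (ω' : Rel ι κ' F')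
    (d₁ : {T : Box ι q // T.deg ≤ n} → MvPolynomial κ' F') (hd₁ : ∀ T, d₁ T ≠ 0)
    (d₂ : Box ι q → MvPolynomial κ' F') (hd₂ : ∀ M, d₂ M ≠ 0)
    (h : ∀ T M, hsMatrix e' q n ω' T M = d₁ T * ψ (hsMatrix e q n ω T M) * d₂ M) :
    profile e' q n ω' = profile e q n ω := by
  refine le_antisymm (profile_le_of_hsMatrix_scaled e e' q ψ n ω ω' d₁ d₂ h) ?_
  by_contra hlt
  push Not at hlt
  obtain ⟨rows, cols, hne⟩ := (le_profile_iff e q n _ ω).mp (Nat.succ_le_of_lt hlt)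
  have hne' : (Matrix.submatrix (hsMatrix e' q n ω') rows cols).det ≠ 0 := by
    rw [det_submatrix_scaled ψ _ _ d₁ d₂ h]
    refine mul_ne_zero (mul_ne_zero ?_ ((map_ne_zero_iff ψ hψ).mpr hne)) ?_
    · exact Finset.prod_ne_zero_iff.mpr fun a _ => hd₁ _
    · exact Finset.prod_ne_zero_iff.mpr fun a _ => hd₂ _
  have := (le_profile_iff e' q n _ ω').mpr ⟨rows, cols, hne'⟩
  omega

omit [DecidableEq ι] in
/-- **Compatible coefficient maps act entrywise on the HS matrix.**
[cite: EGAIV4, Thm. 16.11.2 (functoriality of the D_p)] -/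
theorem hsMatrix_map_of_compat (ψ : MvPolynomial κ F →+* MvPolynomial κ' F')
    (hψ : (dtaylorCoeff (ι := ι) e').comp ψ =
      (MvPolynomial.map (MvPolynomial.map ψ)).comp (dtaylorCoeff e))
    (n : ℕ) (ω : Rel ι κ F) :
    hsMatrix e' q n (MvPolynomial.map ψ ω) = (hsMatrix e q n ω).map ψ := by
  ext T M
  rw [hsMatrix_apply, hsOp_map_of_compat e e' ψ hψ, coeff_map, Matrix.map_apply, hsMatrix_apply]

/-- A compatible coefficient map can only LOWER the profile (e.g. specialising an unpaired
variable: `σ_n(ω|_{a_c = 0}) ≤ σ_n(ω)`, the layer step of MIZUTANI-PROOF-g59 §7).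
[cite: Mizutani1973HironakaGroupSchemes, Remark 2.10 (in-house proof, §7 layer lemma)] -/
theorem profile_map_le_of_compat (ψ : MvPolynomial κ F →+* MvPolynomial κ' F')
    (hψ : (dtaylorCoeff (ι := ι) e').comp ψ =
      (MvPolynomial.map (MvPolynomial.map ψ)).comp (dtaylorCoeff e))
    (n : ℕ) (ω : Rel ι κ F) :
    profile e' q n (MvPolynomial.map ψ ω) ≤ profile e q n ω :=
  profile_le_of_hsMatrix_scaled e e' q ψ n ω _ (fun _ => 1) (fun _ => 1) fun T M => by
    rw [hsMatrix_map_of_compat e e' q ψ hψ, Matrix.map_apply, one_mul, mul_one]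

/-- An INJECTIVE compatible coefficient map preserves the profile (translations `a ↦ a + c`, base
change of the constant field: MIZUTANI-PROOF-g59 §1.4 INVARIANCES, §5 reduction to `C̄`).
[cite: Mizutani1973HironakaGroupSchemes, Remark 2.10 (in-house proof, §1.4 / §5)] -/
theorem profile_map_eq_of_compat (ψ : MvPolynomial κ F →+* MvPolynomial κ' F')
    (hψinj : Function.Injective ψ)
    (hψ : (dtaylorCoeff (ι := ι) e').comp ψ =
      (MvPolynomial.map (MvPolynomial.map ψ)).comp (dtaylorCoeff e))
    (n : ℕ) (ω : Rel ι κ F) :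
    profile e' q n (MvPolynomial.map ψ ω) = profile e q n ω :=
  profile_eq_of_map e q e' ψ hψinj n ω _ (hsMatrix_map_of_compat e e' q ψ hψ n ω)

end Scaled

/-! ## Tori -/

section Torus

variable {ι κ F : Type*} [CommRing F] (e : ι → κ)

/-- Coefficients under a "scale the variables, map the coefficients" substitution:
`coeff_T (P(f; c_i u_i)) = (Π_i c_i^{T_i}) · f(coeff_T P)`. [folklore] -/
theorem coeff_eval₂Hom_scale {R S : Type*} [CommRing R] [CommRing S] (f : R →+* S) (c : ι → S)
    (P : MvPolynomial ι R) (T : ι →₀ ℕ) :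
    coeff T (eval₂Hom (C.comp f) (fun i => C (c i) * X i) P) =
      (T.prod fun i k => c i ^ k) * f (coeff T P) := by
  classical
  induction P using MvPolynomial.induction_on' with
  | monomial N a =>
    have hmon : eval₂Hom (C.comp f) (fun i => C (c i) * X i) (monomial N a) =
        monomial N ((N.prod fun i k => c i ^ k) * f a) := by
      rw [eval₂Hom_monomial, RingHom.comp_apply]
      simp only [mul_pow, ← map_pow]
      rw [Finsupp.prod_mul, ← map_finsuppProd, ← mul_assoc, ← map_mul, mul_comm (f a),
        ← monomial_eq]
    rw [hmon, coeff_monomial, coeff_monomial]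
    split_ifs with h
    · rw [h]
    · rw [map_zero, mul_zero]
  | add P Q hP hQ => rw [map_add, coeff_add, coeff_add, hP, hQ, map_add, mul_add]

/-- The torus on coefficients: `a_k ↦ s^{w_k} a_k` (`s` a scalar of the coefficient ring).
[cite: Mizutani1973HironakaGroupSchemes, Remark 2.10 (in-house proof, §5 AUTOMORPHISMS: tori)] -/
noncomputable def torusCoeff (s : MvPolynomial κ F) (w : κ → ℕ) :
    MvPolynomial κ F →ₐ[F] MvPolynomial κ F :=
  aeval fun k => s ^ w k * X k

/-- The torus on the model ring: `a_k ↦ s^{w_k} a_k`, `t_i ↦ s^{w_{e i}} t_i` (`t_i` scales like its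
paired variable). [cite: Mizutani1973HironakaGroupSchemes, Remark 2.10 (in-house proof, §5 AUTOMORPHISMS: tori)] -/
noncomputable def torus (s : MvPolynomial κ F) (w : κ → ℕ) : Rel ι κ F →+* Rel ι κ F :=
  eval₂Hom (C.comp (torusCoeff s w : MvPolynomial κ F →+* MvPolynomial κ F))
    fun i => C (s ^ w (e i)) * X i

/-- `θ(a_k) = s^{w_k} a_k`. [cite: Mizutani1973HironakaGroupSchemes, Remark 2.10 (in-house proof, §5)] -/
@[simp] theorem torusCoeff_X (s : MvPolynomial κ F) (w : κ → ℕ) (k : κ) :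
    torusCoeff s w (X k) = s ^ w k * X k := aeval_X _ k

/-- `θ` fixes constants. [cite: Mizutani1973HironakaGroupSchemes, Remark 2.10 (in-house proof, §5)] -/
@[simp] theorem torusCoeff_C (s : MvPolynomial κ F) (w : κ → ℕ) (c : F) :
    torusCoeff s w (C c) = C c := by rw [torusCoeff, aeval_C]; rfl

/-- `θ` on coefficients of the model ring. [cite: Mizutani1973HironakaGroupSchemes, Remark 2.10 (in-house proof, §5)] -/
@[simp] theorem torus_C (s : MvPolynomial κ F) (w : κ → ℕ) (κ₀ : MvPolynomial κ F) :
    torus e s w (C κ₀) = C (torusCoeff s w κ₀) := by simp [torus]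

/-- `θ(t_i) = s^{w_{e i}} t_i`. [cite: Mizutani1973HironakaGroupSchemes, Remark 2.10 (in-house proof, §5)] -/
@[simp] theorem torus_X (s : MvPolynomial κ F) (w : κ → ℕ) (i : ι) :
    torus e s w (X i : Rel ι κ F) = C (s ^ w (e i)) * X i := by simp [torus]

variable [Fintype ι]

/-- The weight `w·(e_* M) = Σ_i M_i w_{e i}` of a `t`-exponent.
[cite: Mizutani1973HironakaGroupSchemes, Remark 2.10 (in-house proof, §5 Thm D)] -/
def twt (w : κ → ℕ) (M : ι →₀ ℕ) : ℕ := ∑ i, M i * w (e i)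

/-- `Π_i (s^{w_{e i}})^{M_i} = s^{w·M}`. [folklore] -/
theorem prod_pow_eq_pow_twt {S : Type*} [CommMonoid S] (s : S) (w : κ → ℕ) (M : ι →₀ ℕ) :
    (M.prod fun i k => (s ^ w (e i)) ^ k) = s ^ twt e w M := by
  classical
  unfold twt
  rw [Finsupp.prod, Finset.prod_subset (Finset.subset_univ M.support) fun i _ hi => by
    rw [Finsupp.notMem_support_iff.mp hi, pow_zero]]
  simp only [← pow_mul]
  rw [Finset.prod_pow_eq_pow_sum]
  refine congrArg _ (Finset.sum_congr rfl fun i _ => mul_comm _ _)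

/-- Coefficients after the torus: `coeff_{t^M}(θ ξ) = s^{w·M} θ(coeff_{t^M} ξ)`.
[cite: Mizutani1973HironakaGroupSchemes, Remark 2.10 (in-house proof, §5 Thm D)] -/
theorem coeff_torus (s : MvPolynomial κ F) (w : κ → ℕ) (ξ : Rel ι κ F) (M : ι →₀ ℕ) :
    coeff M (torus e s w ξ) = s ^ twt e w M * torusCoeff s w (coeff M ξ) := by
  rw [torus, coeff_eval₂Hom_scale, prod_pow_eq_pow_twt]
  rfl

/-- The `u`-scaling companion of the torus on the Taylor side: coefficients by `θ`, `u_i ↦ s^{w_{e i}} u_i`.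
[cite: Mizutani1973HironakaGroupSchemes, Remark 2.10 (in-house proof, §5 Thm D)] -/
noncomputable def torusTaylor (s : MvPolynomial κ F) (w : κ → ℕ) :
    MvPolynomial ι (Rel ι κ F) →+* MvPolynomial ι (Rel ι κ F) :=
  eval₂Hom (C.comp (torus e s w)) fun i => C (C (s ^ w (e i))) * X i

variable [DecidableEq κ]

/-- **The torus commutes with the diagonal Taylor morphism up to scaling `u`** (for a scalar `s`
the pairing does not see): `(θω)(a + u, t + u) = θ̃(ω(a + u, t + u))`, `θ̃ : u_i ↦ s^{w_{e i}} u_i`.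
[cite: Mizutani1973HironakaGroupSchemes, Remark 2.10 (in-house proof, §1.4 (P3) / §5 tori)] -/
theorem dtaylor_comp_torus {s : MvPolynomial κ F} (hs : dtaylorCoeff (ι := ι) e s = C (C s))
    (w : κ → ℕ) :
    (dtaylor e).comp (torus e s w) = (torusTaylor e s w).comp (dtaylor e) := by
  have hcoeff : (dtaylorCoeff (ι := ι) e).comp
      (torusCoeff s w : MvPolynomial κ F →+* MvPolynomial κ F) =
      (torusTaylor e s w).comp (dtaylorCoeff e) := by
    refine MvPolynomial.ringHom_ext (fun c => ?_) (fun k => ?_)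
    · simp [torusTaylor]
    · simp only [RingHom.comp_apply, RingHom.coe_coe, torusCoeff_X, map_mul, map_pow, hs,
        dtaylorCoeff_X, torusTaylor, coe_eval₂Hom, eval₂_add, eval₂_C, RingHom.comp_apply,
        torus_C, torusCoeff_X, map_mul, map_pow]
      rw [mul_add]
      congr 1
      unfold uOf
      rw [eval₂_sum, Finset.mul_sum]
      refine Finset.sum_congr rfl fun i hi => ?_
      rw [eval₂_X, (Finset.mem_filter.mp hi).2]
  refine MvPolynomial.ringHom_ext (fun κ₀ => ?_) (fun i => ?_)
  · have h := RingHom.congr_fun hcoeff κ₀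
    simp only [RingHom.comp_apply, RingHom.coe_coe] at h
    rw [RingHom.comp_apply, RingHom.comp_apply, torus_C, dtaylor_C, dtaylor_C]
    exact h
  · simp only [RingHom.comp_apply, torus_X, map_mul, dtaylor_C, dtaylor_X, map_pow, hs,
      torusTaylor, coe_eval₂Hom, eval₂_add, eval₂_C, eval₂_X, RingHom.comp_apply, torus_X]
    ring

/-- **`(D^{(T)}⊗1)(θω) = s^{w·T} · θ((D^{(T)}⊗1)ω)`** for a torus with a scalar the pairing does
not see. [cite: Mizutani1973HironakaGroupSchemes, Remark 2.10 (in-house proof, §1.4 (P3) / §5 tori)] -/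
theorem hsOp_torus {s : MvPolynomial κ F} (hs : dtaylorCoeff (ι := ι) e s = C (C s))
    (w : κ → ℕ) (T : ι →₀ ℕ) (ω : Rel ι κ F) :
    hsOp e T (torus e s w ω) = C (s ^ twt e w T) * torus e s w (hsOp e T ω) := by
  have h := RingHom.congr_fun (dtaylor_comp_torus e hs w) ω
  simp only [RingHom.comp_apply] at h
  rw [hsOp_apply, h, torusTaylor, coeff_eval₂Hom_scale, hsOp_apply]
  congr 1
  rw [← prod_pow_eq_pow_twt e s w T, map_finsuppProd]
  simp only [map_pow]

end Torus

/-! ### Torus invariance of the profile -/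

section TorusProfile

variable {ι κ F : Type*} [Field F] [Fintype ι] [DecidableEq ι] [DecidableEq κ] (e : ι → κ) (q : ℕ)

omit [DecidableEq ι] in
/-- **The HS matrix after a torus**: `HS(θω)[T,M] = s^{w·T} · θ(HS(ω)[T,M]) · s^{w·M}` (scalar `s`
not seen by the pairing). [cite: Mizutani1973HironakaGroupSchemes, Remark 2.10 (in-house proof, §1.4 INVARIANCES / §5 tori)] -/
theorem hsMatrix_torus {s : MvPolynomial κ F} (hs : dtaylorCoeff (ι := ι) e s = C (C s))
    (w : κ → ℕ) (n : ℕ) (ω : Rel ι κ F) (T : {T : Box ι q // T.deg ≤ n}) (M : Box ι q) :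
    hsMatrix e q n (torus e s w ω) T M =
      s ^ twt e w T.1.toF * torusCoeff s w (hsMatrix e q n ω T M) * s ^ twt e w M.toF := by
  rw [hsMatrix_apply, hsOp_torus e hs, coeff_C_mul, coeff_torus, hsMatrix_apply]
  ring

omit [Fintype ι] [DecidableEq ι] [DecidableEq κ] in
/-- The torus with an invertible constant scalar is injective on coefficients (its inverse is the
torus with the inverse scalar). [cite: Mizutani1973HironakaGroupSchemes, Remark 2.10 (in-house proof, §5 AUTOMORPHISMS)] -/
theorem torusCoeff_C_injective {c : F} (hc : c ≠ 0) (w : κ → ℕ) :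
    Function.Injective (torusCoeff (C c) w) := by
  have hcomp : (torusCoeff (C c⁻¹) w).comp (torusCoeff (C c) w) = AlgHom.id F _ := by
    refine MvPolynomial.algHom_ext fun k => ?_
    rw [AlgHom.comp_apply, AlgHom.id_apply, torusCoeff_X, map_mul, map_pow, torusCoeff_C,
      torusCoeff_X, ← mul_assoc, ← mul_pow, ← map_mul, mul_inv_cancel₀ hc, C_1, one_pow, one_mul]
  intro x y hxy
  have h := congrArg (torusCoeff (C c⁻¹) w) hxy
  rwa [← AlgHom.comp_apply, ← AlgHom.comp_apply, hcomp, AlgHom.id_apply, AlgHom.id_apply] at h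

/-- **Torus invariance of the profile** (MIZUTANI-PROOF-g59 §1.4 INVARIANCES, §5 AUTOMORPHISMS:
`σ((θ_λ ⊗ θ_λ)ω) = σ(ω)` for `λ ∈ F^×`). [cite: Mizutani1973HironakaGroupSchemes, Remark 2.10 (in-house proof, §1.4 / §5)] -/
theorem profile_torus {c : F} (hc : c ≠ 0) (w : κ → ℕ) (n : ℕ) (ω : Rel ι κ F) :
    profile e q n (torus e (C c) w ω) = profile e q n ω :=
  profile_eq_of_hsMatrix_scaled e e q (torusCoeff (C c) w : MvPolynomial κ F →+* MvPolynomial κ F)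
    (torusCoeff_C_injective hc w) n ω _ (fun T => C c ^ twt e w T.1.toF)
    (fun _ => pow_ne_zero _ (C_ne_zero.mpr hc)) (fun M => C c ^ twt e w M.toF)
    (fun _ => pow_ne_zero _ (C_ne_zero.mpr hc))
    (fun T M => hsMatrix_torus e q (dtaylorCoeff_C e c) w n ω T M)

end TorusProfile

end Summit.ResolutionOfSingularities.KangarooAtlas.Mizutani
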